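import Summits.QuantumFields.YangMills.Theses.MarginalTwistOnset
import Summits.QuantumFields.YangMills.Theses.ThermalRuler

/-!
# `CentrelessWeakCouplingYangMills` — split glue (crux-strategist decomposition of stmt-QuantumFields-15941)

Support for crux `stmt-QuantumFields-15941`
(`Summit.QuantumFields.YangMills.Theses.MarginalTwistOnset.CentrelessWeakCouplingYangMills`, shared verbatim with
route `FluxBootstrap`): the re-typed Clay clause `YangMills` (weak-coupling scheme, OS data, `IsYangMillsFor`,
non-trivial non-Gaussian curvature, both mass gaps) for the compact simple Lie groups with TRIVIAL centre — the
adjoint forms `PSU(N)`, `SO(2n+1)`, `PSp(n)`, `PSO(2n)`, `E₆/ℤ₃`, `E₇/ℤ₂` and the centreless simply connected `G₂`, `F₄`,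
`E₈` — for which the 't Hooft-flux mechanism of routes `MarginalTwistOnset` / `FluxBootstrap` is void.  The crux is the
summit statement composed with a restriction (`YangMills → crux` is `fun h G _ _ _ _ hG _ => h G hG`, planner folder `bc/`), so the re-audit
binned it RESTATED; this file is the GLUE of the strategist's typed decomposition (BC2 redirect, D-0027 A7, one layer,
`route edit --split CentrelessWeakCouplingYangMills --into … --glue-by`) into the CENTRE-BLIND BRANCH of the infrared-first
programme, whose three pieces are, word for word, items of route `ThermalRuler` (so the children dedup onto staffed items
that already carry registered skeletons):

* **Sub₁ = body of `ThermalRuler.StrongGapSeqAllG`** (stmt-QuantumFields-10417, the INFRARED input): every compact simple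
  Lie `G` has a faithful unitary lattice representation `r` and couplings `b_k → ∞` at which Wilson's theory in `r` has
  strong exponential decay of correlations — cubes of `ℤ⁴`, ARBITRARY boundary conditions `η` through the DLR kernels
  `ymSpecification r.ρ (b k) Λ η`, edge-local observables, `K₁ = 4`, rates `m_k ∈ (0,1]` (Chatterjee 2021, Def. 2.3).
* **Sub₂ = body of `ThermalRuler.SofteningCentreBlind`** (stmt-QuantumFields-10418, the SOFTENING input, centre-blind
  case): for faithful `r` in which NO central element acts by a scalar `≠ 1`, every admissible rate sequence along
  `b_k → ∞` tends to `0` (the strong mixing length diverges in lattice units — the lattice spacing it defines goes to 0).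
* **Sub₃ = body of `ThermalRuler.ContinuumFromMixing`** (stmt-QuantumFields-16115, the ULTRAVIOLET / Osterwalder–Schrader
  leg): strong decay along `b` with SOME admissible rates, plus softening of EVERY admissible rate sequence, give a
  weak-coupling scheme and OS data with `IsYangMillsFor`, non-trivial non-Gaussian curvature and both gaps at `(G, r)`.

`centrelessWeakCouplingYangMills_of_subs : Sub₁ → Sub₂ → Sub₃ → CentrelessWeakCouplingYangMills` (conclusion BY NAME; bodies as
hypotheses, so that the split's children — rendered in `MarginalTwistOnset` with these bodies — match definitionally) and its
by-name twin `centrelessWeakCouplingYangMills_of_thermalRuler : ThermalRuler.StrongGapSeqAllG → ThermalRuler.SofteningCentreBlind →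
ThermalRuler.ContinuumFromMixing → CentrelessWeakCouplingYangMills` (the reduction 15941 ⇐ 10417 ∧ 10418 ∧ 16115 over registered items).
The seam is the infrared / ultraviolet seam of constructive gauge theory, not a conjunct of the crux: `Sub₁` supplies
`(r, b, m)`; since `Z(G) = ⊥` the only central element is `1`, which acts in `r` by the scalar `1` — this needs
`0 < r.N`, true because a faithful representation of a non-abelian group is not `0`-dimensional
(`latticeRep_N_pos`, `not_exists_central_scalar`) — so `r` is centre-blind and `Sub₂` softens every admissible rate
sequence along `b`; `Sub₃` then returns the Clay clause at `(G, r)`.  None of the pieces gives the crux or `YangMills` on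
its own (`Sub₃` is conditional on the IR input, `Sub₁`/`Sub₂` say nothing about a continuum limit; the cheap probes
`Subᵢ → YangMills`, `Subᵢ → crux` by `exact? | simpa | aesop` fail, planner folder `bc/`), and for a centre-CHARGED `r`
of a group with non-trivial centre the softening input is route `ThermalRuler`'s ruler, not `Sub₂` — the decomposition
is one of the centreless clause proper.

References: A. Jaffe, E. Witten, *Quantum Yang–Mills theory* (Clay 2000) §4; S. Chatterjee, Comm. Math. Phys. 385
(2021) 1007, Def. 2.3, Thm. 2.4; C. Borgs, E. Seiler, Comm. Math. Phys. 91 (1983) 329; K. Holland, P. Minkowski,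
M. Pepe, U.-J. Wiese, Nucl. Phys. B 668 (2003) 207 (`G₂`: confinement without a centre).
-/

namespace Summit.QuantumFields.YangMills.Theorems.CentrelessWeakCouplingYangMillsSplit

/-- A faithful matrix representation of a compact simple (hence non-abelian) group has positive degree. [folklore] -/
theorem latticeRep_N_pos {G : Type} [Group G] [TopologicalSpace G] [CompactSpace G]
    (hG : Literature.MathematicalPhysics.QuantumFieldTheory.IsCompactSimpleLieGroup G)
    (r : Literature.MathematicalPhysics.QuantumFieldTheory.LatticeRep G) : 0 < r.N := by
  rcases Nat.eq_zero_or_pos r.N with h | h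
  · exfalso
    obtain ⟨a, b, hab⟩ := hG.1.2.1
    haveI : IsEmpty (Fin r.N) := by rw [h]; infer_instance
    exact hab (r.injective (Subsingleton.elim _ _))
  · exact h

/-- In a group with trivial centre no central element acts, in a faithful representation of positive degree, by a
scalar different from `1` (the only central element is `1`, which acts by the scalar `1`). [folklore] -/
theorem not_exists_central_scalar {G : Type} [Group G] [TopologicalSpace G] [CompactSpace G]
    (hG : Literature.MathematicalPhysics.QuantumFieldTheory.IsCompactSimpleLieGroup G)
    (hc : Subgroup.center G = ⊥) (r : Literature.MathematicalPhysics.QuantumFieldTheory.LatticeRep G) :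
    ¬ ∃ (z : G) (ω : ℂ), (∀ g : G, z * g = g * z) ∧ ω ≠ 1 ∧
      r.ρ z = ω • (1 : Matrix (Fin r.N) (Fin r.N) ℂ) := by
  rintro ⟨z, ω, hz, hω, hρz⟩
  have hz1 : z = 1 := by
    have hmem : z ∈ Subgroup.center G := Subgroup.mem_center_iff.2 fun g => (hz g).symm
    rw [hc] at hmem
    exact Subgroup.mem_bot.1 hmem
  subst hz1
  rw [map_one] at hρz
  have hN : 0 < r.N := latticeRep_N_pos hG r
  have h00 := congr_fun (congr_fun hρz ⟨0, hN⟩) ⟨0, hN⟩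
  simp [Matrix.one_apply_eq, Matrix.smul_apply] at h00
  exact hω h00.symm

/-- **Split glue `centrelessWeakCouplingYangMills_of_subs`** (strategist's decomposition of stmt-QuantumFields-15941):
`Sub₁ → Sub₂ → Sub₃ → MarginalTwistOnset.CentrelessWeakCouplingYangMills`, with `Sub₁, Sub₂, Sub₃` the bodies, word for
word, of `ThermalRuler.StrongGapSeqAllG` (stmt-10417), `ThermalRuler.SofteningCentreBlind` (stmt-10418) and
`ThermalRuler.ContinuumFromMixing` (stmt-16115), and the conclusion the crux BY NAME.  Proof: `Sub₁` gives `(r, b, m)`;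
trivial centre makes `r` centre-blind (`not_exists_central_scalar`), so `Sub₂` softens every admissible rate sequence
along `b`; `Sub₃` concludes at `(G, r)`.  Jaffe–Witten 2000 §4; Chatterjee 2021 Def. 2.3. [folklore] -/
theorem centrelessWeakCouplingYangMills_of_subs :
    (∀ (G : Type) [Group G] [TopologicalSpace G] [IsTopologicalGroup G] [CompactSpace G], Literature.MathematicalPhysics.QuantumFieldTheory.IsCompactSimpleLieGroup G → letI : MeasurableSpace G := borel G; haveI : BorelSpace G := ⟨rfl⟩; ∃ r : Literature.MathematicalPhysics.QuantumFieldTheory.LatticeRep G, (∃ b m : ℕ → ℝ, Filter.Tendsto b Filter.atTop Filter.atTop ∧ ∀ k, 0 < m k ∧ m k ≤ 1 ∧ (∀ (M : ℕ) (v : Fin 4 → ℤ) (Λ : Finset (Literature.MathematicalPhysics.QuantumLattice.ZdEdge 4)) (η : Literature.MathematicalPhysics.QuantumLattice.LGConfig 4 G) (e₁ e₂ : Literature.MathematicalPhysics.QuantumLattice.ZdEdge 4) (f g : Literature.MathematicalPhysics.QuantumLattice.LGConfig 4 G → ℝ), Λ = (((Fintype.piFinset fun j : Fin 4 => Finset.Icc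 (v j) (v j + M)) ×ˢ (Finset.univ : Finset (Fin 4))).filter fun e => e.1 e.2 + 1 ≤ v e.2 + M ∧ ∀ j, j ≠ e.2 → v j < e.1 j ∧ e.1 j < v j + M) → (∀ j, v j ≤ e₁.1 j ∧ e₁.1 j ≤ v j + M) → e₁.1 e₁.2 + 1 ≤ v e₁.2 + M → (∀ j, v j ≤ e₂.1 j ∧ e₂.1 j ≤ v j + M) → e₂.1 e₂.2 + 1 ≤ v e₂.2 + M → Measurable f → Measurable g → Literature.MathematicalPhysics.QuantumLattice.IsCylinder f ((Literature.MathematicalPhysics.QuantumLattice.plaquettesTouching {e₁}).biUnion Literature.MathematicalPhysics.QuantumLattice.plaquetteEdges) → Literature.MathematicalPhysics.QuantumLattice.IsCylinder g ((Literature.MathematicalPhysics.QuantumLattice.plaquettesTouching {e₂}).biUnion Literature.MathematicalPhysics.QuantumLattice.plaquetteEdges) → (∀ U, |f U| ≤ 1) → (∀ U, |g U| ≤ 1) → |(∫ U, f U * g U ∂(Literature.MathematicalPhysics.QuantumLattice.ymSpecification (d := 4) r.ρ (b k) Λ η)) - (∫ U, f U ∂(Literature.MathematicalPhysics.QuantumLattice.ymSpecification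 (d := 4) r.ρ (b k) Λ η)) * (∫ U, g U ∂(Literature.MathematicalPhysics.QuantumLattice.ymSpecification (d := 4) r.ρ (b k) Λ η))| ≤ 4 * Real.exp (-((m k) * ‖e₁.1 - e₂.1‖))))) →
    (∀ (G : Type) [Group G] [TopologicalSpace G] [IsTopologicalGroup G] [CompactSpace G], Literature.MathematicalPhysics.QuantumFieldTheory.IsCompactSimpleLieGroup G → letI : MeasurableSpace G := borel G; haveI : BorelSpace G := ⟨rfl⟩; ∀ r : Literature.MathematicalPhysics.QuantumFieldTheory.LatticeRep G, (¬ ∃ (z : G) (ω : ℂ), (∀ g : G, z * g = g * z) ∧ ω ≠ 1 ∧ r.ρ z = ω • (1 : Matrix (Fin r.N) (Fin r.N) ℂ)) → (∀ (b m : ℕ → ℝ), Filter.Tendsto b Filter.atTop Filter.atTop → (∀ k, 0 < m k ∧ m k ≤ 1 ∧ (∀ (M : ℕ) (v : Fin 4 → ℤ) (Λ : Finset (Literature.MathematicalPhysics.QuantumLattice.ZdEdge 4)) (η : Literature.MathematicalPhysics.QuantumLattice.LGConfig 4 G) (e₁ e₂ : Literature.MathematicalPhysics.QuantumLattice.ZdEdge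 4) (f g : Literature.MathematicalPhysics.QuantumLattice.LGConfig 4 G → ℝ), Λ = (((Fintype.piFinset fun j : Fin 4 => Finset.Icc (v j) (v j + M)) ×ˢ (Finset.univ : Finset (Fin 4))).filter fun e => e.1 e.2 + 1 ≤ v e.2 + M ∧ ∀ j, j ≠ e.2 → v j < e.1 j ∧ e.1 j < v j + M) → (∀ j, v j ≤ e₁.1 j ∧ e₁.1 j ≤ v j + M) → e₁.1 e₁.2 + 1 ≤ v e₁.2 + M → (∀ j, v j ≤ e₂.1 j ∧ e₂.1 j ≤ v j + M) → e₂.1 e₂.2 + 1 ≤ v e₂.2 + M → Measurable f → Measurable g → Literature.MathematicalPhysics.QuantumLattice.IsCylinder f ((Literature.MathematicalPhysics.QuantumLattice.plaquettesTouching {e₁}).biUnion Literature.MathematicalPhysics.QuantumLattice.plaquetteEdges) → Literature.MathematicalPhysics.QuantumLattice.IsCylinder g ((Literature.MathematicalPhysics.QuantumLattice.plaquettesTouching {e₂}).biUnion Literature.MathematicalPhysics.QuantumLattice.plaquetteEdges) → (∀ U, |f U| ≤ 1) → (∀ U, |g U| ≤ 1) → |(∫ U, f U * g U ∂(Literature.MathematicalPhysics.QuantumLattice.ymSpecification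 (d := 4) r.ρ (b k) Λ η)) - (∫ U, f U ∂(Literature.MathematicalPhysics.QuantumLattice.ymSpecification (d := 4) r.ρ (b k) Λ η)) * (∫ U, g U ∂(Literature.MathematicalPhysics.QuantumLattice.ymSpecification (d := 4) r.ρ (b k) Λ η))| ≤ 4 * Real.exp (-((m k) * ‖e₁.1 - e₂.1‖)))) → Filter.Tendsto m Filter.atTop (nhds 0))) →
    (∀ (G : Type) [Group G] [TopologicalSpace G] [IsTopologicalGroup G] [CompactSpace G], Literature.MathematicalPhysics.QuantumFieldTheory.IsCompactSimpleLieGroup G → letI : MeasurableSpace G := borel G; haveI : BorelSpace G := ⟨rfl⟩; ∀ (r : Literature.MathematicalPhysics.QuantumFieldTheory.LatticeRep G) (b : ℕ → ℝ), Filter.Tendsto b Filter.atTop Filter.atTop → (∃ m : ℕ → ℝ, ∀ k, 0 < m k ∧ m k ≤ 1 ∧ (∀ (M : ℕ) (v : Fin 4 → ℤ) (Λ : Finset (Literature.MathematicalPhysics.QuantumLattice.ZdEdge 4)) (η : Literature.MathematicalPhysics.QuantumLattice.LGConfig 4 G) (e₁ e₂ : Literature.MathematicalPhysics.QuantumLattice.ZdEdge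 4) (f g : Literature.MathematicalPhysics.QuantumLattice.LGConfig 4 G → ℝ), Λ = (((Fintype.piFinset fun j : Fin 4 => Finset.Icc (v j) (v j + M)) ×ˢ (Finset.univ : Finset (Fin 4))).filter fun e => e.1 e.2 + 1 ≤ v e.2 + M ∧ ∀ j, j ≠ e.2 → v j < e.1 j ∧ e.1 j < v j + M) → (∀ j, v j ≤ e₁.1 j ∧ e₁.1 j ≤ v j + M) → e₁.1 e₁.2 + 1 ≤ v e₁.2 + M → (∀ j, v j ≤ e₂.1 j ∧ e₂.1 j ≤ v j + M) → e₂.1 e₂.2 + 1 ≤ v e₂.2 + M → Measurable f → Measurable g → Literature.MathematicalPhysics.QuantumLattice.IsCylinder f ((Literature.MathematicalPhysics.QuantumLattice.plaquettesTouching {e₁}).biUnion Literature.MathematicalPhysics.QuantumLattice.plaquetteEdges) → Literature.MathematicalPhysics.QuantumLattice.IsCylinder g ((Literature.MathematicalPhysics.QuantumLattice.plaquettesTouching {e₂}).biUnion Literature.MathematicalPhysics.QuantumLattice.plaquetteEdges) → (∀ U, |f U| ≤ 1) → (∀ U, |g U| ≤ 1) → |(∫ U, f U * g U ∂(Literature.MathematicalPhysics.QuantumLattice.ymSpecification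 (d := 4) r.ρ (b k) Λ η)) - (∫ U, f U ∂(Literature.MathematicalPhysics.QuantumLattice.ymSpecification (d := 4) r.ρ (b k) Λ η)) * (∫ U, g U ∂(Literature.MathematicalPhysics.QuantumLattice.ymSpecification (d := 4) r.ρ (b k) Λ η))| ≤ 4 * Real.exp (-((m k) * ‖e₁.1 - e₂.1‖)))) → (∀ m : ℕ → ℝ, (∀ k, 0 < m k ∧ m k ≤ 1 ∧ (∀ (M : ℕ) (v : Fin 4 → ℤ) (Λ : Finset (Literature.MathematicalPhysics.QuantumLattice.ZdEdge 4)) (η : Literature.MathematicalPhysics.QuantumLattice.LGConfig 4 G) (e₁ e₂ : Literature.MathematicalPhysics.QuantumLattice.ZdEdge 4) (f g : Literature.MathematicalPhysics.QuantumLattice.LGConfig 4 G → ℝ), Λ = (((Fintype.piFinset fun j : Fin 4 => Finset.Icc (v j) (v j + M)) ×ˢ (Finset.univ : Finset (Fin 4))).filter fun e => e.1 e.2 + 1 ≤ v e.2 + M ∧ ∀ j, j ≠ e.2 → v j < e.1 j ∧ e.1 j < v j + M) → (∀ j, v j ≤ e₁.1 j ∧ e₁.1 j ≤ v j + M) → e₁.1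 e₁.2 + 1 ≤ v e₁.2 + M → (∀ j, v j ≤ e₂.1 j ∧ e₂.1 j ≤ v j + M) → e₂.1 e₂.2 + 1 ≤ v e₂.2 + M → Measurable f → Measurable g → Literature.MathematicalPhysics.QuantumLattice.IsCylinder f ((Literature.MathematicalPhysics.QuantumLattice.plaquettesTouching {e₁}).biUnion Literature.MathematicalPhysics.QuantumLattice.plaquetteEdges) → Literature.MathematicalPhysics.QuantumLattice.IsCylinder g ((Literature.MathematicalPhysics.QuantumLattice.plaquettesTouching {e₂}).biUnion Literature.MathematicalPhysics.QuantumLattice.plaquetteEdges) → (∀ U, |f U| ≤ 1) → (∀ U, |g U| ≤ 1) → |(∫ U, f U * g U ∂(Literature.MathematicalPhysics.QuantumLattice.ymSpecification (d := 4) r.ρ (b k) Λ η)) - (∫ U, f U ∂(Literature.MathematicalPhysics.QuantumLattice.ymSpecification (d := 4) r.ρ (b k) Λ η)) * (∫ U, g U ∂(Literature.MathematicalPhysics.QuantumLattice.ymSpecification (d := 4) r.ρ (b k) Λ η))| ≤ 4 * Real.exp (-((m k) * ‖e₁.1 - e₂.1‖)))) → Filter.Tendsto m Filter.atTop (nhds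 0)) → ∃ (sch : Literature.MathematicalPhysics.QuantumFieldTheory.SpeciesScheme (Literature.MathematicalPhysics.QuantumFieldTheory.YMSpecies G)) (T : Literature.MathematicalPhysics.QuantumFieldTheory.OSData (Literature.MathematicalPhysics.QuantumFieldTheory.YMSpecies G) 4), sch.HasWeakCouplingLimit ∧ Literature.MathematicalPhysics.QuantumFieldTheory.IsYangMillsFor r sch T ∧ T.IsNontrivial r.curvature ∧ T.IsNonGaussian r.curvature ∧ ∃ Δ > 0, T.HasMassGap Δ ∧ Literature.MathematicalPhysics.QuantumFieldTheory.HasLatticeMassGap r sch Δ) →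
    Summit.QuantumFields.YangMills.Theses.MarginalTwistOnset.CentrelessWeakCouplingYangMills := by
  intro hSG hSCB hC G _ _ _ _ hG hc
  obtain ⟨r, b, m, hb, hval⟩ := hSG G hG
  have hblind := not_exists_central_scalar hG hc r
  exact ⟨r, hC G hG r b hb ⟨m, hval⟩ fun m' hm' => hSCB G hG r hblind b m' hb hm'⟩

/-- **The same glue BY NAME** (the form the ledger reads as a reduction): the three `ThermalRuler` items
`StrongGapSeqAllG` (stmt-QuantumFields-10417), `SofteningCentreBlind` (stmt-QuantumFields-10418) and
`ContinuumFromMixing` (stmt-QuantumFields-16115) imply `MarginalTwistOnset.CentrelessWeakCouplingYangMills`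
(stmt-QuantumFields-15941).  Definitional unfolding of `centrelessWeakCouplingYangMills_of_subs`, whose hypotheses are
those items' bodies word for word. [folklore] -/
theorem centrelessWeakCouplingYangMills_of_thermalRuler :
    Summit.QuantumFields.YangMills.Theses.ThermalRuler.StrongGapSeqAllG →
    Summit.QuantumFields.YangMills.Theses.ThermalRuler.SofteningCentreBlind →
    Summit.QuantumFields.YangMills.Theses.ThermalRuler.ContinuumFromMixing →
    Summit.QuantumFields.YangMills.Theses.MarginalTwistOnset.CentrelessWeakCouplingYangMills :=
  centrelessWeakCouplingYangMills_of_subs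

end Summit.QuantumFields.YangMills.Theorems.CentrelessWeakCouplingYangMillsSplit
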